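import Literature.AnabelianGeometry.AbsoluteAnabelian.AbsTopIII.EquivariantUnitAutomorphisms
import HarnessLib

/-!
# [AbsTopIII] Def 3.1 (v) / Prop 3.3 (ii): the automorphisms of the cyclotome `μ_Ẑ(k̄) = Λ(k̄ˣ)`
# are the `Ẑ^×`-powers

Proof-only companion (theorems only, no new definitions) in the lane of `MonoidKummerMaps.lean`
(seat abc-iut-L4-t2; S. Mochizuki, *Topics in Absolute Anabelian Geometry III*, Def. 3.1 (v) p. 69
"the cyclotome … is isomorphic to `Ẑ`", Prop. 3.3 (ii) p. 74 (`Isom(μ_Ẑ(M), μ_Ẑ(M*))`); kurims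
manuscript, lit key `paper:url-5493eb38cbb7`).  The cyclotome is the tree's
`EtaleTheta.cyclotome A` (compatible systems `(ζ_n)_n`, `ζ_n^n = 1`, `ζ_{nm}^m = ζ_n`).

* `cyclotome_eq_pow_of_apply_eq_one`, `cyclotome_mulEquiv_apply_congr` (any commutative group):
  the kernel of the projection `ζ ↦ ζ_n` is the subgroup of `n`-th powers, so an automorphism of the
  cyclotome induces a map on each level;
* `MLFClosure.cyclotome_exists_apply_eq` — for the model data `(k, k̄)` every `n`-th root of unity is
  the `n`-th component of an element of `Λ(k̄ˣ)` (compatible root systems, `RootSystem.ofRootableBy`);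
* `MLFClosure.cyclotome_mulEquiv_exponents` — **every group automorphism `w` of `Λ(k̄ˣ)` is
  `ζ ↦ ζ^a` for a compatible UNIT exponent system `a`** (`(w ζ)_n = ζ_n^{a n}`, `a n ≡ a m (mod m)`
  for `m ∣ n`, `a n` prime to `n`): abstract automorphisms of `Ẑ(1) ≅ Ẑ` are automatically
  "continuous", `Aut(Ẑ) = Ẑ^×`.

Used (next file) to reduce the `TCG` surjectivity clauses of Prop. 3.3 (ii)
(`UnitPairIsoFibresOfType`, `TCGPairIsoLiftsOfMonoAnalytic`) to the existence of ONE lift, via the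
`Ẑ^×`-torsor theorems of `EquivariantUnitExponents.lean`.  HONEST FRAMING: OUR kernel check of a
classical statement; nothing here bears on [IUTchIII] Cor. 3.12.
-/

noncomputable section

namespace Literature.AnabelianGeometry.AbsoluteAnabelian

open Literature.AnabelianGeometry.EtaleTheta (RootSystem)

universe u

/-! ### Generalities on the cyclotome of a commutative group -/

section General

variable {A : Type u} [CommGroup A]

/-- An element of the cyclotome whose `n`-th component is trivial is an `n`-th power (of the shifted
system `k ↦ ζ_{nk}`). [cite: MochizukiAbsTopIII2015, Definition 3.1 (v) p.69] -/
theorem cyclotome_eq_pow_of_apply_eq_one (ζ : EtaleTheta.cyclotome A) (n : ℕ+) (h : (ζ : ℕ+ → A) n = 1) :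
    ∃ ξ : EtaleTheta.cyclotome A, ζ = ξ ^ (n : ℕ) := by
  refine ⟨⟨fun k => (ζ : ℕ+ → A) (n * k), fun k => ?_, fun k m => ?_⟩, ?_⟩
  · change (ζ : ℕ+ → A) (n * k) ^ (k : ℕ) = 1
    rw [EtaleTheta.cyclotome.pow_apply_mul, h]
  · change (ζ : ℕ+ → A) (n * (k * m)) ^ (m : ℕ) = (ζ : ℕ+ → A) (n * k)
    rw [← mul_assoc]
    exact EtaleTheta.cyclotome.pow_apply_mul ζ (n * k) m
  · apply Subtype.ext
    funext k
    change (ζ : ℕ+ → A) k = ((ζ : ℕ+ → A) (n * k)) ^ (n : ℕ)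
    rw [mul_comm n k, EtaleTheta.cyclotome.pow_apply_mul]

/-- The `n`-th component of `w ζ`, for an automorphism (indeed any endomorphism) `w` of the cyclotome,
only depends on the `n`-th component of `ζ`. [cite: MochizukiAbsTopIII2015, Definition 3.1 (v) p.69] -/
theorem cyclotome_map_apply_congr (w : EtaleTheta.cyclotome A →* EtaleTheta.cyclotome A) (ζ ζ' : EtaleTheta.cyclotome A) (n : ℕ+)
    (h : (ζ : ℕ+ → A) n = (ζ' : ℕ+ → A) n) :
    ((w ζ : EtaleTheta.cyclotome A) : ℕ+ → A) n = ((w ζ' : EtaleTheta.cyclotome A) : ℕ+ → A) n := by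
  have h1 : ((ζ * ζ'⁻¹ : EtaleTheta.cyclotome A) : ℕ+ → A) n = 1 := by
    change (ζ : ℕ+ → A) n * ((ζ' : ℕ+ → A) n)⁻¹ = 1
    rw [h, mul_inv_cancel]
  obtain ⟨ξ, hξ⟩ := cyclotome_eq_pow_of_apply_eq_one (ζ * ζ'⁻¹) n h1
  have h2 : ζ = ξ ^ (n : ℕ) * ζ' := by rw [← hξ, inv_mul_cancel_right]
  rw [h2, map_mul, map_pow]
  change ((w ξ : EtaleTheta.cyclotome A) : ℕ+ → A) n ^ (n : ℕ) * ((w ζ' : EtaleTheta.cyclotome A) : ℕ+ → A) n = _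
  rw [EtaleTheta.cyclotome.pow_eq_one, one_mul]

end General

/-! ### The cyclotome `Λ(k̄ˣ)` of the model data -/

section Model

variable (C : MLFClosure.{u})

/-- `k̄ˣ` is divisible: every unit has an `n`-th root (`k̄` algebraically closed).
[cite: MochizukiAbsTopIII2015, Definition 3.1 (i) p.66] -/
theorem MLFClosure.units_exists_pow_eq (a : (C.K)ˣ) (n : ℕ) (hn : 0 < n) : ∃ r : (C.K)ˣ, r ^ n = a := by
  haveI : IsAlgClosed C.K := IsAlgClosure.isAlgClosed C.k
  obtain ⟨y, hy⟩ := IsAlgClosed.exists_pow_nat_eq (a : C.K) hn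
  have hy0 : y ≠ 0 := by
    rintro rfl; rw [zero_pow hn.ne'] at hy; exact a.ne_zero hy.symm
  exact ⟨Units.mk0 y hy0, Units.ext (by simp [Units.val_pow_eq_pow_val, hy])⟩

/-- Every `n`-th root of unity of `k̄` is the `n`-th component of an element of the cyclotome `Λ(k̄ˣ)`
(choose a compatible system of roots). [cite: MochizukiAbsTopIII2015, Definition 3.1 (v) p.69] -/
theorem MLFClosure.cyclotome_exists_apply_eq (z : (C.K)ˣ) (n : ℕ+) (hz : z ^ (n : ℕ) = 1) :
    ∃ ζ : EtaleTheta.cyclotome (C.K)ˣ, (ζ : ℕ+ → (C.K)ˣ) n = z := by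
  classical
  letI : RootableBy (C.K)ˣ ℕ := rootableByOfPowLeftSurj (C.K)ˣ ℕ fun {k} hk a =>
    MLFClosure.units_exists_pow_eq C a k (Nat.pos_of_ne_zero hk)
  set s : RootSystem z := RootSystem.ofRootableBy z
  refine ⟨⟨fun i => s.root i ^ (n : ℕ), fun i => ?_, fun i i' => ?_⟩, ?_⟩
  · rw [← pow_mul, mul_comm, pow_mul, s.pow_self, hz]
  · rw [← pow_mul, mul_comm (n : ℕ) (i' : ℕ), pow_mul, s.root_mul_pow]
  · change s.root n ^ (n : ℕ) = z
    exact s.pow_self n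

/-- `k̄ˣ` has primitive roots of unity of every order. [cite: MochizukiAbsTopIII2015, Definition 3.1 (i) p.66] -/
theorem MLFClosure.exists_isPrimitiveRoot_units (n : ℕ) (hn : 0 < n) :
    ∃ ζ : (C.K)ˣ, IsPrimitiveRoot ζ n := by
  obtain ⟨z, hz⟩ := C.exists_isPrimitiveRoot n hn
  exact ⟨(hz.isUnit hn.ne').unit, IsPrimitiveRoot.coe_units_iff.mp (by simpa using hz)⟩

/-- **Automorphisms of the cyclotome are `Ẑ^×`-powers.**  For every group automorphism `w` of
`Λ(k̄ˣ) = μ_Ẑ(k̄)` there is a compatible unit exponent system `a : ℕ → ℕ` (`a n ≡ a m (mod m)` for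
`m ∣ n`, `a n` prime to `n`) with `(w ζ)_n = ζ_n ^ {a n}` for all `ζ` and `n`: an abstract automorphism
preserves the subgroups of `n`-th powers = the kernels of the projections to `μ_n`, hence acts on each
`μ_n` (cyclic of order `n`) by a unit exponent, compatibly.
[cite: MochizukiAbsTopIII2015, Proposition 3.3 (ii) p.74] -/
theorem MLFClosure.cyclotome_mulEquiv_exponents (w : EtaleTheta.cyclotome (C.K)ˣ ≃* EtaleTheta.cyclotome (C.K)ˣ) :
    ∃ a : ℕ → ℕ, (∀ m n : ℕ, 0 < m → 0 < n → m ∣ n → a n ≡ a m [MOD m]) ∧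
      (∀ n, 0 < n → (a n).Coprime n) ∧
      ∀ (ζ : EtaleTheta.cyclotome (C.K)ˣ) (n : ℕ+), ((w ζ : EtaleTheta.cyclotome (C.K)ˣ) : ℕ+ → (C.K)ˣ) n =
        (ζ : ℕ+ → (C.K)ˣ) n ^ a n := by
  classical
  -- per level `N`: a primitive root `z N`, a lift `f N` to the cyclotome, and the exponent `e N`
  have hlev : ∀ N : ℕ+, ∃ (z : (C.K)ˣ) (f : EtaleTheta.cyclotome (C.K)ˣ) (e : ℕ),
      IsPrimitiveRoot z (N : ℕ) ∧ (f : ℕ+ → (C.K)ˣ) N = z ∧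
      ((w f : EtaleTheta.cyclotome (C.K)ˣ) : ℕ+ → (C.K)ˣ) N = z ^ e := by
    intro N
    haveI : NeZero (N : ℕ) := ⟨N.ne_zero⟩
    obtain ⟨z, hz⟩ := C.exists_isPrimitiveRoot_units N N.pos
    obtain ⟨f, hf⟩ := C.cyclotome_exists_apply_eq z N hz.pow_eq_one
    have hwn : (((w f : EtaleTheta.cyclotome (C.K)ˣ) : ℕ+ → (C.K)ˣ) N : C.K) ^ (N : ℕ) = 1 := by
      rw [← Units.val_pow_eq_pow_val, EtaleTheta.cyclotome.pow_eq_one (w f) N, Units.val_one]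
    obtain ⟨e, -, he⟩ := (IsPrimitiveRoot.coe_units_iff.mpr hz).eq_pow_of_pow_eq_one hwn
    exact ⟨z, f, e, hz, hf, Units.ext (by rw [Units.val_pow_eq_pow_val, he])⟩
  choose z f e hz hf he using hlev
  -- the formula at each level, for every element of the cyclotome
  have formula : ∀ (N : ℕ+) (ζ : EtaleTheta.cyclotome (C.K)ˣ),
      ((w ζ : EtaleTheta.cyclotome (C.K)ˣ) : ℕ+ → (C.K)ˣ) N = (ζ : ℕ+ → (C.K)ˣ) N ^ e N := by
    intro N ζ
    haveI : NeZero (N : ℕ) := ⟨N.ne_zero⟩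
    have hζn : (((ζ : ℕ+ → (C.K)ˣ) N : (C.K)ˣ) : C.K) ^ (N : ℕ) = 1 := by
      rw [← Units.val_pow_eq_pow_val, EtaleTheta.cyclotome.pow_eq_one ζ N, Units.val_one]
    obtain ⟨i, -, hi⟩ := (IsPrimitiveRoot.coe_units_iff.mpr (hz N)).eq_pow_of_pow_eq_one hζn
    have hζi : (ζ : ℕ+ → (C.K)ˣ) N = z N ^ i := Units.ext (by rw [Units.val_pow_eq_pow_val, hi])
    have hfi : ((f N ^ i : EtaleTheta.cyclotome (C.K)ˣ) : ℕ+ → (C.K)ˣ) N = z N ^ i := by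
      change (f N : ℕ+ → (C.K)ˣ) N ^ i = _
      rw [hf N]
    have hc : ((w ζ : EtaleTheta.cyclotome (C.K)ˣ) : ℕ+ → (C.K)ˣ) N =
        ((w (f N ^ i) : EtaleTheta.cyclotome (C.K)ˣ) : ℕ+ → (C.K)ˣ) N :=
      cyclotome_map_apply_congr w.toMonoidHom ζ (f N ^ i) N (hζi.trans hfi.symm)
    rw [hc, map_pow]
    change ((w (f N) : EtaleTheta.cyclotome (C.K)ˣ) : ℕ+ → (C.K)ˣ) N ^ i = _
    rw [he N, hζi, ← pow_mul, ← pow_mul, mul_comm]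
  refine ⟨fun n => if hn : 0 < n then e ⟨n, hn⟩ else 0, ?_, ?_, ?_⟩
  · -- compatibility
    intro m n hm hn hmn
    simp only [hm, hn, dif_pos]
    obtain ⟨k, hk⟩ := hmn
    have hk0 : 0 < k := Nat.pos_of_ne_zero fun h => by subst h; omega
    set M : ℕ+ := ⟨m, hm⟩
    set N : ℕ+ := ⟨n, hn⟩
    set P : ℕ+ := ⟨k, hk0⟩
    have hpn : N = M * P := Subtype.ext hk
    set F := f M
    have h1 : ((w F : EtaleTheta.cyclotome (C.K)ˣ) : ℕ+ → (C.K)ˣ) M = z M ^ e M := he M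
    have h2 : ((w F : EtaleTheta.cyclotome (C.K)ˣ) : ℕ+ → (C.K)ˣ) N = (F : ℕ+ → (C.K)ˣ) N ^ e N :=
      formula N F
    have h3 : ((w F : EtaleTheta.cyclotome (C.K)ˣ) : ℕ+ → (C.K)ˣ) N ^ k =
        ((w F : EtaleTheta.cyclotome (C.K)ˣ) : ℕ+ → (C.K)ˣ) M := by
      have := EtaleTheta.cyclotome.pow_apply_mul (w F) M P
      rwa [← hpn] at this
    have h4 : (F : ℕ+ → (C.K)ˣ) N ^ k = z M := by
      have := EtaleTheta.cyclotome.pow_apply_mul F M P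
      rw [← hpn] at this
      exact this.trans (hf M)
    -- `z_m ^ e m = (F_n ^ e n) ^ k = z_m ^ e n`
    have h5 : z M ^ e M = z M ^ e N := by
      rw [← h1, ← h3, h2, ← pow_mul, mul_comm, pow_mul, h4]
    have hzK : IsPrimitiveRoot ((z M : (C.K)ˣ) : C.K) m := IsPrimitiveRoot.coe_units_iff.mpr (hz M)
    have hzm : ((z M : (C.K)ˣ) : C.K) ^ m = 1 := hzK.pow_eq_one
    have h6 : ((z M : (C.K)ˣ) : C.K) ^ (e M % m) = ((z M : (C.K)ˣ) : C.K) ^ (e N % m) := by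
      rw [C.pow_eq_pow_of_modEq hzm (Nat.mod_modEq _ m), C.pow_eq_pow_of_modEq hzm (Nat.mod_modEq _ m),
        ← Units.val_pow_eq_pow_val, ← Units.val_pow_eq_pow_val, h5]
    exact (hzK.pow_inj (Nat.mod_lt _ hm) (Nat.mod_lt _ hm) h6).symm
  · -- units: `w` is surjective onto `f N`
    intro n hn
    simp only [hn, dif_pos]
    set N : ℕ+ := ⟨n, hn⟩
    haveI : NeZero n := ⟨hn.ne'⟩
    obtain ⟨ξ, hξ⟩ := w.surjective (f N)
    have h1 := formula N ξ
    rw [hξ, hf N] at h1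
    -- h1 : z N = ξ_N ^ e N, and ξ_N = z N ^ i
    have hξn : (((ξ : ℕ+ → (C.K)ˣ) N : (C.K)ˣ) : C.K) ^ n = 1 := by
      rw [← Units.val_pow_eq_pow_val]
      exact (congrArg Units.val (EtaleTheta.cyclotome.pow_eq_one ξ N)).trans Units.val_one
    have hzK : IsPrimitiveRoot ((z N : (C.K)ˣ) : C.K) n := IsPrimitiveRoot.coe_units_iff.mpr (hz N)
    obtain ⟨i, -, hi⟩ := hzK.eq_pow_of_pow_eq_one hξn
    have h2 : ((z N : (C.K)ˣ) : C.K) ^ 1 = ((z N : (C.K)ˣ) : C.K) ^ (e N * i) := by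
      rw [pow_one, pow_mul', hi, ← Units.val_pow_eq_pow_val, ← h1]
    have hzn : ((z N : (C.K)ˣ) : C.K) ^ n = 1 := hzK.pow_eq_one
    have h3 : ((z N : (C.K)ˣ) : C.K) ^ (1 % n) = ((z N : (C.K)ˣ) : C.K) ^ (e N * i % n) := by
      rw [C.pow_eq_pow_of_modEq hzn (Nat.mod_modEq _ n), C.pow_eq_pow_of_modEq hzn (Nat.mod_modEq _ n), h2]
    have h4 : e N * i ≡ 1 [MOD n] := (hzK.pow_inj (Nat.mod_lt _ hn) (Nat.mod_lt _ hn) h3).symm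
    exact Nat.coprime_of_mul_modEq_one i h4
  · -- the formula
    intro ζ n
    simp only [n.pos, dif_pos]
    exact formula n ζ

end Model

end Literature.AnabelianGeometry.AbsoluteAnabelian

end
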